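import Summits.QuantumFields.BalabanUV.Beta.FP.CoarseCovarianceStripMatrix

/-!
# `BalabanUV.Beta.FP.CoarseCovarianceStripCalculus` — road «FP» (binder row D1), row H′2-IR ∕ IR-2 (ii)∕(iv), [folklore] toolkit:
# **ENTRYWISE HOLOMORPHY OF `det`, `adjugate`, products and the INVERSE of a matrix of holomorphic functions of ONE complex variable**
# (Leibniz expansion + Cramer `A⁻¹ = det⁻¹ • adj`), and the MATRIX-VALUED CONTINUITY of the inverse where `det ≠ 0`

HONEST FRAMING (cell contract, verbatim): «discharging `BetaPertH` makes Bałaban's UV stability UNCONDITIONAL — a real constructive-QFT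
result; it is NOT the continuum limit and NOT the Clay problem.»  HONEST DEPENDENCY (verbatim): «continuum YM on T⁴ ⇐ BetaPertH ∧ nine
spine estimates (0/9 proved); BetaPertH ⇐ (D1) ∧ (D4) ∧ CAP+tail; G-an2-4 gates asym, D1 and NE2/3/4.»  THIS MODULE DISCHARGES NOTHING of
D1 ∕ BetaPertH: [folklore] one-variable calculus ∕ point-set topology over Mathlib (`Matrix.det_apply'`, `Matrix.adjugate_apply`, `Matrix.inv_def`,
`DifferentiableAt.fun_finsetProd`, `continuousAt_matrix_inv`) — the regularity inputs of the slice holomorphy (`StripRegular.diff`) and continuity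
(`StripRegular.cont`) of the coarse covariance INVERSE symbol `GC = N • Dwmi₀·Bn⁻¹·feynC(k/n)·Dwi₀` of file (ii).  No def; no `def … : Prop`; nothing is
cited; 0 sorry.  NOT summit progress; NOT BetaPertH, NOT continuum, NOT Clay.

CONTENT (square matrices over `Fin m`, entries `ℂ`).
* §1 one complex variable, pointwise: `differentiableAt_det` (entries differentiable at `z` ⟹ `det` differentiable at `z`), `differentiableAt_updateRow_det`,
  `differentiableAt_adjugate_apply'`, `inv_apply_eq` (`A⁻¹ i j = (det A)⁻¹·adj A i j`), **`differentiableAt_inv_apply`** (`det (A z) ≠ 0` ⟹ the entries of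
  `w ↦ (A w)⁻¹` are differentiable at `z`), `differentiableAt_mul_apply`, `differentiableAt_smul_apply`.
* §2 matrix-valued continuity: `continuousWithinAt_matrix_of_entries` ∕ `continuousWithinAt_entry_of_matrix`, **`continuousWithinAt_matrix_inv_of_det`**
  (`det (A x) ≠ 0`), `continuousOn_matrix_inv_of_det`.
Unit `b2b-balaban-beta-d1-formalise-leaf-06` (gen 8), owner ruling R-FP-21 (A3)∕(C).
-/

noncomputable section

namespace Summit.QuantumFields.BalabanUV.Beta.FP.CoarseCovarianceStripCalculus

open Finset Complex Set Matrix
open scoped BigOperators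

variable {m : ℕ}

/-! ## §1 Entrywise holomorphy of `det`, `adjugate`, inverse, products -/

/-- [folklore] **the determinant of a matrix of functions differentiable at `z` is differentiable at `z`** (Leibniz expansion). -/
theorem differentiableAt_det {A : ℂ → Matrix (Fin m) (Fin m) ℂ} {z : ℂ} (hA : ∀ i j, DifferentiableAt ℂ (fun w => A w i j) z) :
    DifferentiableAt ℂ (fun w => (A w).det) z := by
  simp only [Matrix.det_apply']
  refine DifferentiableAt.fun_sum fun σ _ => ?_
  refine DifferentiableAt.const_mul ?_ _
  exact DifferentiableAt.fun_finsetProd fun i _ => hA (σ i) i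

/-- [folklore] replacing one row by a constant row keeps entrywise differentiability; hence the row-replaced determinant is differentiable. -/
theorem differentiableAt_updateRow_det {A : ℂ → Matrix (Fin m) (Fin m) ℂ} {z : ℂ} (hA : ∀ i j, DifferentiableAt ℂ (fun w => A w i j) z)
    (j : Fin m) (c : Fin m → ℂ) : DifferentiableAt ℂ (fun w => ((A w).updateRow j c).det) z := by
  refine differentiableAt_det fun i l => ?_
  by_cases h : i = j
  · subst h
    simp only [Matrix.updateRow_self]
    exact differentiableAt_const _
  · simp only [Matrix.updateRow_ne h]
    exact hA i l

/-- [folklore] the entries of the adjugate of a matrix of functions differentiable at `z` are differentiable at `z`. -/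
theorem differentiableAt_adjugate_apply' {A : ℂ → Matrix (Fin m) (Fin m) ℂ} {z : ℂ} (hA : ∀ i j, DifferentiableAt ℂ (fun w => A w i j) z)
    (i j : Fin m) : DifferentiableAt ℂ (fun w => (A w).adjugate i j) z := by
  simp only [Matrix.adjugate_apply]
  exact differentiableAt_updateRow_det hA j (Pi.single i 1)

/-- [folklore] Cramer: `A⁻¹ i j = (det A)⁻¹ · adj A i j` (Mathlib's `Matrix.inv_def` over a field). -/
theorem inv_apply_eq (C : Matrix (Fin m) (Fin m) ℂ) (i j : Fin m) : C⁻¹ i j = C.det⁻¹ * C.adjugate i j := by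
  rw [Matrix.inv_def, Matrix.smul_apply, Ring.inverse_eq_inv', smul_eq_mul]

/-- [folklore] **THE ENTRIES OF THE INVERSE OF A MATRIX OF FUNCTIONS DIFFERENTIABLE AT `z` ARE DIFFERENTIABLE AT `z` WHEN `det (A z) ≠ 0`.** -/
theorem differentiableAt_inv_apply {A : ℂ → Matrix (Fin m) (Fin m) ℂ} {z : ℂ} (hA : ∀ i j, DifferentiableAt ℂ (fun w => A w i j) z)
    (hdet : (A z).det ≠ 0) (i j : Fin m) : DifferentiableAt ℂ (fun w => (A w)⁻¹ i j) z := by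
  simp only [inv_apply_eq]
  exact ((differentiableAt_det hA).inv hdet).mul (differentiableAt_adjugate_apply' hA i j)

/-- [folklore] the entries of a product of matrices of functions differentiable at `z` are differentiable at `z`. -/
theorem differentiableAt_mul_apply {A B : ℂ → Matrix (Fin m) (Fin m) ℂ} {z : ℂ} (hA : ∀ i j, DifferentiableAt ℂ (fun w => A w i j) z)
    (hB : ∀ i j, DifferentiableAt ℂ (fun w => B w i j) z) (i j : Fin m) : DifferentiableAt ℂ (fun w => (A w * B w) i j) z := by
  simp only [Matrix.mul_apply]
  exact DifferentiableAt.fun_sum fun l _ => (hA i l).mul (hB l j)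

/-- [folklore] the entries of `1 + A` are differentiable at `z` when those of `A` are. -/
theorem differentiableAt_one_add_apply {A : ℂ → Matrix (Fin m) (Fin m) ℂ} {z : ℂ} (hA : ∀ i j, DifferentiableAt ℂ (fun w => A w i j) z)
    (i j : Fin m) : DifferentiableAt ℂ (fun w => (1 + A w) i j) z := by
  simp only [Matrix.add_apply]
  exact (differentiableAt_const _).add (hA i j)

/-- [folklore] the entries of `c • A` are differentiable at `z` when those of `A` are. -/
theorem differentiableAt_smul_apply {A : ℂ → Matrix (Fin m) (Fin m) ℂ} {z : ℂ} (hA : ∀ i j, DifferentiableAt ℂ (fun w => A w i j) z) (c : ℂ)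
    (i j : Fin m) : DifferentiableAt ℂ (fun w => (c • A w) i j) z := by
  simp only [Matrix.smul_apply, smul_eq_mul]
  exact (hA i j).const_mul c

/-- [folklore] the entries of a diagonal matrix of functions differentiable at `z` are differentiable at `z`. -/
theorem differentiableAt_diagonal_apply {v : ℂ → Fin m → ℂ} {z : ℂ} (hv : ∀ i, DifferentiableAt ℂ (fun w => v w i) z) (i j : Fin m) :
    DifferentiableAt ℂ (fun w => diagonal (v w) i j) z := by
  by_cases h : i = j
  · subst h
    simp only [diagonal_apply_eq]
    exact hv i
  · simp only [diagonal_apply_ne _ h]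
    exact differentiableAt_const _

/-! ## §2 Matrix-valued continuity -/

section Continuity

variable {X : Type*} [TopologicalSpace X]

/-- [folklore] entrywise continuity within a set gives matrix-valued continuity within the set (product topology). -/
theorem continuousWithinAt_matrix_of_entries {A : X → Matrix (Fin m) (Fin m) ℂ} {s : Set X} {x : X}
    (hA : ∀ i j, ContinuousWithinAt (fun y => A y i j) s x) : ContinuousWithinAt A s x :=
  continuousWithinAt_pi.mpr fun i => continuousWithinAt_pi.mpr fun j => hA i j

/-- [folklore] matrix-valued continuity within a set gives entrywise continuity within the set. -/
theorem continuousWithinAt_entry_of_matrix {A : X → Matrix (Fin m) (Fin m) ℂ} {s : Set X} {x : X} (hA : ContinuousWithinAt A s x)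
    (i j : Fin m) : ContinuousWithinAt (fun y => A y i j) s x :=
  continuousWithinAt_pi.mp (continuousWithinAt_pi.mp hA i) j

/-- [folklore] entrywise `ContinuousOn` gives matrix-valued `ContinuousOn`. -/
theorem continuousOn_matrix_of_entries {A : X → Matrix (Fin m) (Fin m) ℂ} {s : Set X} (hA : ∀ i j, ContinuousOn (fun y => A y i j) s) :
    ContinuousOn A s := fun x hx => continuousWithinAt_matrix_of_entries fun i j => hA i j x hx

/-- [folklore] matrix-valued `ContinuousOn` gives entrywise `ContinuousOn`. -/
theorem continuousOn_entry_of_matrix {A : X → Matrix (Fin m) (Fin m) ℂ} {s : Set X} (hA : ContinuousOn A s) (i j : Fin m) :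
    ContinuousOn (fun y => A y i j) s := fun x hx => continuousWithinAt_entry_of_matrix (hA x hx) i j

/-- [folklore] **THE MATRIX INVERSE IS CONTINUOUS WITHIN A SET AT A POINT WHERE `det ≠ 0`** (Mathlib's `continuousAt_matrix_inv` on the field `ℂ`). -/
theorem continuousWithinAt_matrix_inv_of_det {A : X → Matrix (Fin m) (Fin m) ℂ} {s : Set X} {x : X} (hA : ContinuousWithinAt A s x)
    (hdet : (A x).det ≠ 0) : ContinuousWithinAt (fun y => (A y)⁻¹) s x := by
  have h : ContinuousAt Ring.inverse (A x).det := by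
    rw [Ring.inverse_eq_inv']
    exact continuousAt_inv₀ hdet
  exact (continuousAt_matrix_inv (A x) h).comp_continuousWithinAt hA

/-- [folklore] hence `ContinuousOn` of the inverse on a set where `det ≠ 0`. -/
theorem continuousOn_matrix_inv_of_det {A : X → Matrix (Fin m) (Fin m) ℂ} {s : Set X} (hA : ContinuousOn A s)
    (hdet : ∀ x ∈ s, (A x).det ≠ 0) : ContinuousOn (fun y => (A y)⁻¹) s := fun x hx =>
  continuousWithinAt_matrix_inv_of_det (hA x hx) (hdet x hx)

/-- [folklore] `ContinuousOn` of a matrix product from the factors (matrix-valued). -/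
theorem continuousOn_matrix_mul {A B : X → Matrix (Fin m) (Fin m) ℂ} {s : Set X} (hA : ContinuousOn A s) (hB : ContinuousOn B s) :
    ContinuousOn (fun y => A y * B y) s := hA.mul hB

/-- [folklore] `ContinuousOn` of a diagonal matrix from its diagonal (matrix-valued). -/
theorem continuousOn_matrix_diagonal {v : X → Fin m → ℂ} {s : Set X} (hv : ∀ i, ContinuousOn (fun y => v y i) s) :
    ContinuousOn (fun y => diagonal (v y)) s := by
  refine continuousOn_matrix_of_entries fun i j => ?_
  by_cases h : i = j
  · subst h
    simp only [diagonal_apply_eq]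
    exact hv i
  · simp only [diagonal_apply_ne _ h]
    exact continuousOn_const

end Continuity

end Summit.QuantumFields.BalabanUV.Beta.FP.CoarseCovarianceStripCalculus

end
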